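import Summits.HodgeConjecture.HodgeConjecture.Cruxes.BlochSeedDiscOne.RingFourEmpty
import Summits.HodgeConjecture.HodgeConjecture.Cruxes.BlochSeedDiscOne.RingFiveEmpty

/-!
# LegAClosure — (i) Leg A of the widened (A4) road is closed by the depth bound `c₀ = 5` in every filed form;
# (ii) the STRONG rings: rings ≤ 5 are empty WITHOUT `μ ≠ 0`, WITHOUT the rank floor, and using only the e-free half of (A1) (gs-eng-2 g59)

Token: line stmt-HodgeConjecture-18881 Cruxes/BlochSeedDiscOne/Lines/birth.lean 814a6a70c14e831a stub_rung_pad4_seedAt.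

(i) `RingFiveEmpty.ringsEmpty_14_199_8_5` is in the tree; the remaining DEPTH half of the director's closing equation (l.8748
«`DepthBound 14 199 8 c₀ ∧ RingsEmpty 14 199 8 c₀` for some `c₀ ≤ 5`») may be supplied as `DepthBound 14 199 8 5`
(`RingFiveEmpty.a4_closed_of_depthBound_five`), as the P-letters-only `DepthBoundP 14 199 8 5` (`a4_closed_of_depthBoundP_five`), or as
hsemireg-colour-1's six-hypothesis `DB 5` (`a4sharp_closed_of_DB_five`, closing the road for (A4♯) ∧ (CONN) designs).
(ii) STRONG RINGS (monad-2 g3's reading at ring 4, l.9397: «μ ≠ 0 and rank are IDLE»; colour-1's `DepthBoundStrong` shape): the `μ`-branches of both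
ring files (no `D`∕`F` letter on the P side) are in fact EMPTY BY (A1) + (A4) ALONE — the class-tuple LP `{e-free rows = 0, Σ_P m ≥ 1}` is
infeasible, with Farkas certificates `γ4s` (ring 4) ∕ `γ00s` (ring 5) checked here by `decide` through the ring files' own `chkN∕chkP` ∕ `chkN5∕chkP5`
and consumed by their own `branch_pos` with `L = 0`.  Hence `RingsEmptyStrong 14 B 4` (`B ≤ 997`) and `RingsEmptyStrong 14 B 5` (`B ≤ 199`): no
NON-ZERO (A1)-clean (A4) design with `M ≤ B` has all its letters at co-level `≤ 4` resp. `≤ 5` — characteristic-class content (`μ`) and rank never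
enter; moreover only the e-FREE agreement clause (A1).2 =: `Design.A1e` is consumed (`RingsEmptyE`, `ringsEmptyE_colevel_four∕five`, proved through
verbatim copies `orbit_row_e ∕ G_vanishes_e ∕ branch_pos_e` of the tree proofs with the weaker hypothesis), so the mixed-word clause (A1).1 is idle as
well.  `RingsEmptyStrong` (full (A1)) and `RingsEmpty` follow (`ringsEmptyStrong_of_E`, `ringsEmpty_of_strong`); with `DepthBoundStrong 14 199 5` the road
would close for zero-`μ` designs too (`strong_closed_of_depthBoundStrong_five`).
Own exact LP (`work/ring5/strongcert.py`); no `axiom` ∕ `instance` ∕ `sorry` ∕ `native_decide`.  Nothing here proves any depth bound.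
Letter model ≠ sheaves ≠ SEED; nothing here is proved toward HC/HC_CM/HC_AV/№4/26512/18881/H2.
-/

set_option linter.dupNamespace false
set_option autoImplicit false

/-! ## §0 The e-free (A1) hypothesis and the strong ring statements (data-model namespace) -/

namespace Summit.HodgeConjecture.HodgeConjecture.Cruxes.BlochSeedDiscOne.DepthBoundA4

/-- (A1).2 alone: e-free words of equal degree have equal tensor coefficient («the e-free part of `ch(𝓔)` is a polynomial in `h₁+h₂+h₃+h₄`»).
This is the ONLY part of (A1) the ring certificates consume; the mixed-word clause (A1).1 is never used. -/
def Design.A1e (D : Design) : Prop :=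
  ∀ w w' : Word, w.efree → w'.efree → w.deg = w'.deg → D.T w = D.T w'

theorem Design.a1e_of_a1 (D : Design) (h1 : D.A1) : D.A1e := h1.2

/-- (A1e), integer form. -/
theorem Tz_eq_of_A1e (D : Design) (h1 : D.A1e) (w w' : Word) (hw : w.efree) (hw' : w'.efree) (hd : w.deg = w'.deg) :
    D.Tz w = D.Tz w' := by
  have h := h1 w w' hw hw' hd
  rw [T_eq_cast_Tz D w hw, T_eq_cast_Tz D w' hw'] at h
  exact_mod_cast h

/-- STRONGEST ring emptiness typed here: no NON-ZERO e-free-clean (A1e) (A4) design with copy count `≤ B` has all supported letters of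
co-level `≤ c₀` — no mixed-word cleanness, no `μ`, no rank floor. -/
def RingsEmptyE (h : ℤ) (B : ℕ) (c₀ : ℤ) : Prop :=
  ∀ D : Design, D.OnAlphabet h → D.A1e → D.A4 → D.suppP ≠ [] → D.copies ≤ B →
    (∀ c ∈ D.suppN ++ D.suppP, ∀ f : Fin 4, (c f).colevel ≤ c₀) → False

/-- STRONG ring emptiness: the same with the full (A1) (still no `μ`, no rank floor). -/
def RingsEmptyStrong (h : ℤ) (B : ℕ) (c₀ : ℤ) : Prop :=
  ∀ D : Design, D.OnAlphabet h → D.A1 → D.A4 → D.suppP ≠ [] → D.copies ≤ B →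
    (∀ c ∈ D.suppN ++ D.suppP, ∀ f : Fin 4, (c f).colevel ≤ c₀) → False

theorem ringsEmptyStrong_of_E (h : ℤ) (B : ℕ) (c₀ : ℤ) (hs : RingsEmptyE h B c₀) : RingsEmptyStrong h B c₀ :=
  fun D hA h1 h4 hne hB hc => hs D hA (D.a1e_of_a1 h1) h4 hne hB hc

/-- `μ ≠ 0` forces a supported P-cell (an (A4) design with empty P side has empty N side and `μ = 0`), so STRONG ⇒ `RingsEmpty` for every rank floor. -/
theorem ringsEmpty_of_strong (h : ℤ) (B : ℕ) (rmin c₀ : ℤ) (hs : RingsEmptyStrong h B c₀) : RingsEmpty h B rmin c₀ :=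
  fun D hA h1 h4 hμ hB _ hc => hs D hA h1 h4 (fun hnil => hμ (RingFiveEmpty.mu_zero_of_suppP_nil D h4 hnil)) hB hc

/-- The strong two-piece closure: `DepthBoundStrong ∧ RingsEmptyStrong ⇒` no non-zero (A1)-clean (A4) design with `M ≤ B` at all. -/
theorem a4_closed_strong (h : ℤ) (B : ℕ) (c₀ : ℤ) (hd : DepthBoundStrong h B c₀) (hr : RingsEmptyStrong h B c₀) :
    ∀ D : Design, D.OnAlphabet h → D.A1 → D.A4 → D.suppP ≠ [] → D.copies ≤ B → False :=
  fun D hA h1 h4 hne hB => hr D hA h1 h4 hne hB (hd D hA h1 h4 hB)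

end Summit.HodgeConjecture.HodgeConjecture.Cruxes.BlochSeedDiscOne.DepthBoundA4

/-! ## §1 STRONG RING 4 (`B ≤ 997`): the `k = 0` branch closed by (A1) + (A4) alone -/

namespace Summit.HodgeConjecture.HodgeConjecture.Cruxes.BlochSeedDiscOne.RingFourEmpty

open Summit.HodgeConjecture.HodgeConjecture.Cruxes.BlochSeedDiscOne.DepthBoundA4

/-- μ-free certificate for `k = 0` (no `D` on the P side, no `Q` on the N side): `G ≤ 0` on N, `G ≥ 30392544` on P. -/
def γ0s : Coefs := ⟨30392544, 30392544, 30392544, 30392544, -9834106, 380441⟩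
theorem chkN0s_ok : chkN 0 γ0s 0 = true := by decide
theorem chkP0s_ok : chkP 0 γ0s 0 30392544 = true := by decide

/-- `orbit_row` under (A1e) only (verbatim the tree proof with `Tz_eq_of_A1e`). -/
theorem orbit_row_e (D : Design) (h1 : D.A1e) (ref : Word) (href : efreeB ref = true) (d : ℕ) (hd : ref.deg = d)
    (ws : List Word) (hws : ∀ w ∈ ws, efreeB w = true ∧ Word.deg w = d) :
    linZ D.N (SO ws) - linZ D.P (SO ws) = (ws.length : ℤ) * D.Tz ref := by
  induction ws with
  | nil => simp [SO, linZ]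
  | cons w t ih =>
    have hw := hws w List.mem_cons_self
    have ht := ih fun w' hw' => hws w' (List.mem_cons_of_mem _ hw')
    have hTz : D.Tz w = D.Tz ref :=
      Tz_eq_of_A1e D h1 w ref (efree_of_efreeB w hw.1) (efree_of_efreeB ref href) (hw.2.trans hd.symm)
    have eN : linZ D.N (SO (w :: t)) = linZ D.N (fun c => icellCoef c w) + linZ D.N (SO t) := by
      rw [← linZ_add]; rfl
    have eP : linZ D.P (SO (w :: t)) = linZ D.P (fun c => icellCoef c w) + linZ D.P (SO t) := by
      rw [← linZ_add]; rfl
    rw [eN, eP, List.length_cons, Nat.cast_succ]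
    unfold Design.Tz at hTz ht ⊢
    linear_combination hTz + ht

/-- `G_vanishes` under (A1e) only. -/
theorem G_vanishes_e (D : Design) (h1 : D.A1e) (γ : Coefs) : linZ D.N (Gcell γ) - linZ D.P (Gcell γ) = 0 := by
  have rHH := orbit_row_e D h1 ref2 (by decide) 2 (by decide) wordsHH wordsHH_ok
  have rP := orbit_row_e D h1 ref2 (by decide) 2 (by decide) wordsP wordsP_ok
  have rHHH := orbit_row_e D h1 ref3 (by decide) 3 (by decide) wordsHHH wordsHHH_ok
  have rPH := orbit_row_e D h1 ref3 (by decide) 3 (by decide) wordsPH wordsPH_ok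
  have rHHHH := orbit_row_e D h1 ref4 (by decide) 4 (by decide) wordsHHHH wordsHHHH_ok
  have rPHH := orbit_row_e D h1 ref4 (by decide) 4 (by decide) wordsPHH wordsPHH_ok
  have rPP := orbit_row_e D h1 ref4 (by decide) 4 (by decide) wordsPP wordsPP_ok
  have rPHHH := orbit_row_e D h1 ref5 (by decide) 5 (by decide) wordsPHHH wordsPHHH_ok
  have rPPH := orbit_row_e D h1 ref5 (by decide) 5 (by decide) wordsPPH wordsPPH_ok
  have rPPHH := orbit_row_e D h1 ref6 (by decide) 6 (by decide) wordsPPHH wordsPPHH_ok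
  have rPPP := orbit_row_e D h1 ref6 (by decide) 6 (by decide) wordsPPP wordsPPP_ok
  rw [wordsHH_length] at rHH; rw [wordsP_length] at rP; rw [wordsHHH_length] at rHHH; rw [wordsPH_length] at rPH
  rw [wordsHHHH_length] at rHHHH; rw [wordsPHH_length] at rPHH; rw [wordsPP_length] at rPP; rw [wordsPHHH_length] at rPHHH
  rw [wordsPPH_length] at rPPH; rw [wordsPPHH_length] at rPPHH; rw [wordsPPP_length] at rPPP
  rw [linZ_Gcell, linZ_Gcell]
  push_cast at *
  linear_combination γ.g2 * (2 * rHH - 3 * rP) + γ.g3 * (3 * rHHH - rPH) + γ.g4 * (12 * rHHHH - rPHH)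
    + γ.g5 * (rPHH - 2 * rPP) + γ.g6 * (3 * rPHHH - rPPH) + γ.g7 * (2 * rPPHH - 3 * rPPP)

/-- `branch_pos` under (A1e) only (verbatim the tree proof with `G_vanishes_e`). -/
theorem branch_pos_e (D : Design) (h1 : D.A1e) (hP : ∀ x ∈ D.suppP, ∀ f, PAdm (x f)) (hN : ∀ y ∈ D.suppN, ∀ f, NAdm (y f))
    (k : ℕ) (x₀ : Cell) (hx₀ : x₀ ∈ D.suppP) (hk₀ : dcount x₀ = k)
    (hmaxP : ∀ x ∈ D.suppP, dcount x ≤ k) (hmaxN : ∀ y ∈ D.suppN, qcount y ≤ k)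
    (γ : Coefs) (L Y : ℤ) (hY : 0 ≤ Y) (hcN : chkN k γ L = true) (hcP : chkP k γ L Y = true) :
    Y ≤ L * (D.copies : ℤ) := by
  let ind : Cell → ℤ := fun c => if dcount c = k then 1 else 0
  have hNle : linZ D.N (Gcell γ) ≤ L * ((D.N.map Prod.snd).sum : ℕ) := by
    refine linZ_le_mul_sum D.N (Gcell γ) L fun cm hcm hpos => ?_
    have hmem : cm.1 ∈ D.suppN := (mem_suppN_iff D cm.1).mpr ⟨cm.2, by simpa using hcm, hpos⟩
    exact N_bound k γ L hcN cm.1 (hN cm.1 hmem) (hmaxN cm.1 hmem)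
  have hPle : linZ D.P (fun c => (-1) * Gcell γ c + Y * ind c) ≤ L * ((D.P.map Prod.snd).sum : ℕ) := by
    refine linZ_le_mul_sum D.P _ L fun cm hcm hpos => ?_
    have hmem : cm.1 ∈ D.suppP := (mem_suppP_iff D cm.1).mpr ⟨cm.2, by simpa using hcm, hpos⟩
    have := P_bound k γ L Y hcP cm.1 (hP cm.1 hmem) (hmaxP cm.1 hmem)
    linarith
  have hsplit : linZ D.P (fun c => (-1) * Gcell γ c + Y * ind c) = (-1) * linZ D.P (Gcell γ) + Y * linZ D.P ind := by
    rw [linZ_add, linZ_smul, linZ_smul]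
  have hvan := G_vanishes_e D h1 γ
  obtain ⟨m₀, hm₀, hpos₀⟩ := (mem_suppP_iff D x₀).mp hx₀
  have hind0 : ∀ c, 0 ≤ ind c := fun c => by
    show 0 ≤ (if dcount c = k then (1 : ℤ) else 0)
    split <;> norm_num
  have hind1 : (m₀ : ℤ) * ind x₀ ≤ linZ D.P ind := term_le_linZ D.P ind hind0 x₀ m₀ hm₀
  have hx1 : ind x₀ = 1 := by
    show (if dcount x₀ = k then (1 : ℤ) else 0) = 1
    rw [if_pos hk₀]
  have hm1 : (1 : ℤ) ≤ m₀ := by exact_mod_cast hpos₀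
  have hge : 1 ≤ linZ D.P ind := by rw [hx1, mul_one] at hind1; linarith
  have hYle : Y ≤ Y * linZ D.P ind := by nlinarith
  unfold Design.copies
  rw [Nat.cast_add]
  rw [hsplit] at hPle
  linarith

/-- **STRONGEST RING 4**: `RingsEmptyE 14 B 4` for every `B ≤ 997` — e-free cleanness + liveness + budget alone. -/
theorem ringsEmptyE_colevel_four (B : ℕ) (hB : B ≤ 997) : RingsEmptyE 14 B 4 := by
  intro D hA h1 h4 hnil hcop hc
  have hP := P_adm D hA h4 hc
  have hN := N_adm D hA h4 hc
  have hNQ := N_qcount D hA h4 hc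
  have hne : D.suppP.toFinset.Nonempty := by
    rw [Finset.nonempty_iff_ne_empty, Ne, List.toFinset_eq_empty_iff]
    exact hnil
  obtain ⟨x₀, hx₀', hmax'⟩ := D.suppP.toFinset.exists_max_image dcount hne
  have hx₀ : x₀ ∈ D.suppP := List.mem_toFinset.mp hx₀'
  have hmaxP : ∀ x ∈ D.suppP, dcount x ≤ dcount x₀ := fun x hx => hmax' x (List.mem_toFinset.mpr hx)
  have hmaxN : ∀ y ∈ D.suppN, qcount y ≤ dcount x₀ := fun y hy => by
    obtain ⟨x, hx, hle⟩ := hNQ y hy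
    exact le_trans hle (hmaxP x hx)
  have hcopZ : (D.copies : ℤ) ≤ 997 := by exact_mod_cast le_trans hcop hB
  have h4' := dcount_le_four x₀
  rcases (show dcount x₀ = 0 ∨ dcount x₀ = 1 ∨ dcount x₀ = 2 ∨ dcount x₀ = 3 ∨ dcount x₀ = 4 by omega) with
    hk | hk | hk | hk | hk
  · rw [hk] at hmaxP hmaxN
    have := branch_pos_e D h1 hP hN 0 x₀ hx₀ hk hmaxP hmaxN γ0s 0 30392544 (by norm_num) chkN0s_ok chkP0s_ok
    linarith
  · rw [hk] at hmaxP hmaxN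
    have := branch_pos_e D h1 hP hN 1 x₀ hx₀ hk hmaxP hmaxN γ1 0 234240 (by norm_num) chkN1_ok chkP1_ok
    linarith
  · rw [hk] at hmaxP hmaxN
    have := branch_pos_e D h1 hP hN 2 x₀ hx₀ hk hmaxP hmaxN γ2 24 29232 (by norm_num) chkN2_ok chkP2_ok
    linarith
  · rw [hk] at hmaxP hmaxN
    have := branch_pos_e D h1 hP hN 3 x₀ hx₀ hk hmaxP hmaxN γ3 576 574944 (by norm_num) chkN3_ok chkP3_ok
    linarith
  · rw [hk] at hmaxP hmaxN
    have := branch_pos_e D h1 hP hN 4 x₀ hx₀ hk hmaxP hmaxN γ4 192 410304 (by norm_num) chkN4_ok chkP4_ok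
    linarith

/-- **STRONG RING 4** (full (A1), no μ, no rank): `RingsEmptyStrong 14 B 4` for every `B ≤ 997`. -/
theorem ringsEmptyStrong_colevel_four (B : ℕ) (hB : B ≤ 997) : RingsEmptyStrong 14 B 4 :=
  ringsEmptyStrong_of_E 14 B 4 (ringsEmptyE_colevel_four B hB)

/-- the instance of record in strong form -/
theorem ringsEmptyStrong_14_199_4 : RingsEmptyStrong 14 199 4 := ringsEmptyStrong_colevel_four 199 (by norm_num)

end Summit.HodgeConjecture.HodgeConjecture.Cruxes.BlochSeedDiscOne.RingFourEmpty

/-! ## §2 STRONG RING 5 (`B ≤ 199`): the `(kF, kDF) = (0, 0)` branch closed by (A1) + (A4) alone; Leg A corollaries -/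

namespace Summit.HodgeConjecture.HodgeConjecture.Cruxes.BlochSeedDiscOne.RingFiveEmpty

open Summit.HodgeConjecture.HodgeConjecture.Cruxes.BlochSeedDiscOne.DepthBoundA4

/-- μ-free certificate for `(kF, kDF) = (0, 0)` (P letters in `A,B,C,E`; N letters in `H,X13,X12,X11`): `G ≤ 0` on N, `G ≥ 690144` on P. -/
def γ00s : Coefs := ⟨-33578720, 690144, 690144, 690144, -161570, 5121⟩
theorem chkN_00s : chkN5 4 0 0 γ00s 0 = true := by decide
theorem chkP_00s : chkP5 4 0 0 γ00s 0 0 690144 0 = true := by decide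

/-- `orbit_row` under (A1e) only (verbatim the tree proof with `Tz_eq_of_A1e`). -/
theorem orbit_row_e (D : Design) (h1 : D.A1e) (ref : Word) (href : efreeB ref = true) (d : ℕ) (hd : ref.deg = d)
    (ws : List Word) (hws : ∀ w ∈ ws, efreeB w = true ∧ Word.deg w = d) :
    linZ D.N (SO ws) - linZ D.P (SO ws) = (ws.length : ℤ) * D.Tz ref := by
  induction ws with
  | nil => simp [SO, linZ]
  | cons w t ih =>
    have hw := hws w List.mem_cons_self
    have ht := ih fun w' hw' => hws w' (List.mem_cons_of_mem _ hw')
    have hTz : D.Tz w = D.Tz ref :=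
      Tz_eq_of_A1e D h1 w ref (efree_of_efreeB w hw.1) (efree_of_efreeB ref href) (hw.2.trans hd.symm)
    have eN : linZ D.N (SO (w :: t)) = linZ D.N (fun c => icellCoef c w) + linZ D.N (SO t) := by
      rw [← linZ_add]; rfl
    have eP : linZ D.P (SO (w :: t)) = linZ D.P (fun c => icellCoef c w) + linZ D.P (SO t) := by
      rw [← linZ_add]; rfl
    rw [eN, eP, List.length_cons, Nat.cast_succ]
    unfold Design.Tz at hTz ht ⊢
    linear_combination hTz + ht

/-- `G_vanishes` under (A1e) only. -/
theorem G_vanishes_e (D : Design) (h1 : D.A1e) (γ : Coefs) : linZ D.N (Gcell γ) - linZ D.P (Gcell γ) = 0 := by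
  have rHH := orbit_row_e D h1 ref2 (by decide) 2 (by decide) wordsHH wordsHH_ok
  have rP := orbit_row_e D h1 ref2 (by decide) 2 (by decide) wordsP wordsP_ok
  have rHHH := orbit_row_e D h1 ref3 (by decide) 3 (by decide) wordsHHH wordsHHH_ok
  have rPH := orbit_row_e D h1 ref3 (by decide) 3 (by decide) wordsPH wordsPH_ok
  have rHHHH := orbit_row_e D h1 ref4 (by decide) 4 (by decide) wordsHHHH wordsHHHH_ok
  have rPHH := orbit_row_e D h1 ref4 (by decide) 4 (by decide) wordsPHH wordsPHH_ok
  have rPP := orbit_row_e D h1 ref4 (by decide) 4 (by decide) wordsPP wordsPP_ok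
  have rPHHH := orbit_row_e D h1 ref5 (by decide) 5 (by decide) wordsPHHH wordsPHHH_ok
  have rPPH := orbit_row_e D h1 ref5 (by decide) 5 (by decide) wordsPPH wordsPPH_ok
  have rPPHH := orbit_row_e D h1 ref6 (by decide) 6 (by decide) wordsPPHH wordsPPHH_ok
  have rPPP := orbit_row_e D h1 ref6 (by decide) 6 (by decide) wordsPPP wordsPPP_ok
  rw [wordsHH_length] at rHH; rw [wordsP_length] at rP; rw [wordsHHH_length] at rHHH; rw [wordsPH_length] at rPH
  rw [wordsHHHH_length] at rHHHH; rw [wordsPHH_length] at rPHH; rw [wordsPP_length] at rPP; rw [wordsPHHH_length] at rPHHH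
  rw [wordsPPH_length] at rPPH; rw [wordsPPHH_length] at rPPHH; rw [wordsPPP_length] at rPPP
  rw [linZ_Gcell, linZ_Gcell]
  push_cast at *
  linear_combination γ.g2 * (2 * rHH - 3 * rP) + γ.g3 * (3 * rHHH - rPH) + γ.g4 * (12 * rHHHH - rPHH)
    + γ.g5 * (rPHH - 2 * rPP) + γ.g6 * (3 * rPHHH - rPPH) + γ.g7 * (2 * rPPHH - 3 * rPPP)

/-- `branch_pos` under (A1e) only (verbatim the tree proof with `G_vanishes_e`). -/
theorem branch_pos_e (D : Design) (h1 : D.A1e) (hP : ∀ x ∈ D.suppP, ∀ f, PAdm (x f)) (hN : ∀ y ∈ D.suppN, ∀ f, NAdm (y f))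
    (kE kF kDF : ℕ)
    (hPE : ∀ x ∈ D.suppP, ecount x ≤ kE) (hPF : ∀ x ∈ D.suppP, fcount x ≤ kF) (hPDF : ∀ x ∈ D.suppP, dfcount x ≤ kDF)
    (hNE : ∀ y ∈ D.suppN, x11count y ≤ kE) (hNF : ∀ y ∈ D.suppN, nbcount y ≤ kF) (hNDF : ∀ y ∈ D.suppN, qnbcount y ≤ kDF)
    (γ : Coefs) (L YE YF YDF : ℤ) (hYE : 0 ≤ YE) (hYF : 0 ≤ YF) (hYDF : 0 ≤ YDF)
    (hattE : YE = 0 ∨ ∃ x ∈ D.suppP, ecount x = kE) (hattF : YF = 0 ∨ ∃ x ∈ D.suppP, fcount x = kF)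
    (hattDF : YDF = 0 ∨ ∃ x ∈ D.suppP, dfcount x = kDF)
    (hcN : chkN5 kE kF kDF γ L = true) (hcP : chkP5 kE kF kDF γ L YE YF YDF = true) :
    YE + YF + YDF ≤ L * (D.copies : ℤ) := by
  let iE : Cell → ℤ := fun c => if ecount c = kE then 1 else 0
  let iF : Cell → ℤ := fun c => if fcount c = kF then 1 else 0
  let iDF : Cell → ℤ := fun c => if dfcount c = kDF then 1 else 0
  have hNle : linZ D.N (Gcell γ) ≤ L * ((D.N.map Prod.snd).sum : ℕ) := by
    refine linZ_le_mul_sum D.N (Gcell γ) L fun cm hcm hpos => ?_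
    have hmem : cm.1 ∈ D.suppN := (mem_suppN_iff D cm.1).mpr ⟨cm.2, by simpa using hcm, hpos⟩
    exact N_bound kE kF kDF γ L hcN cm.1 (hN cm.1 hmem) (hNE cm.1 hmem) (hNF cm.1 hmem) (hNDF cm.1 hmem)
  have hPle : linZ D.P (fun c => (-1) * Gcell γ c + (YE * iE c + (YF * iF c + YDF * iDF c)))
      ≤ L * ((D.P.map Prod.snd).sum : ℕ) := by
    refine linZ_le_mul_sum D.P _ L fun cm hcm hpos => ?_
    have hmem : cm.1 ∈ D.suppP := (mem_suppP_iff D cm.1).mpr ⟨cm.2, by simpa using hcm, hpos⟩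
    have := P_bound kE kF kDF γ L YE YF YDF hcP cm.1 (hP cm.1 hmem) (hPE cm.1 hmem) (hPF cm.1 hmem) (hPDF cm.1 hmem)
    show (-1) * Gcell γ cm.1 + (YE * iE cm.1 + (YF * iF cm.1 + YDF * iDF cm.1)) ≤ L
    linarith
  have hsplit : linZ D.P (fun c => (-1) * Gcell γ c + (YE * iE c + (YF * iF c + YDF * iDF c)))
      = (-1) * linZ D.P (Gcell γ) + (YE * linZ D.P iE + (YF * linZ D.P iF + YDF * linZ D.P iDF)) := by
    rw [linZ_add, linZ_smul, linZ_add, linZ_smul, linZ_add, linZ_smul, linZ_smul]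
  have hvan := G_vanishes_e D h1 γ
  have hE' := cover_term_ge D ecount kE YE hYE hattE
  have hF' := cover_term_ge D fcount kF YF hYF hattF
  have hDF' := cover_term_ge D dfcount kDF YDF hYDF hattDF
  unfold Design.copies
  rw [Nat.cast_add]
  rw [hsplit] at hPle
  change YE ≤ YE * linZ D.P iE at hE'
  change YF ≤ YF * linZ D.P iF at hF'
  change YDF ≤ YDF * linZ D.P iDF at hDF'
  linarith

/-- **STRONGEST RING 5**: `RingsEmptyE 14 B 5` for every `B ≤ 199` — e-free cleanness + liveness + budget alone. -/
theorem ringsEmptyE_colevel_five (B : ℕ) (hB : B ≤ 199) : RingsEmptyE 14 B 5 := by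
  intro D hA h1 h4 hnil hcop hc
  have hP := P_adm D hA h4 hc
  have hN := N_adm D hA h4 hc
  have hNC := N_counts D hA h4 hc
  have hne : D.suppP.toFinset.Nonempty := by
    rw [Finset.nonempty_iff_ne_empty, Ne, List.toFinset_eq_empty_iff]
    exact hnil
  -- the three maxima
  obtain ⟨xE, hxE', hmaxE'⟩ := D.suppP.toFinset.exists_max_image ecount hne
  obtain ⟨xF, hxF', hmaxF'⟩ := D.suppP.toFinset.exists_max_image fcount hne
  obtain ⟨xDF, hxDF', hmaxDF'⟩ := D.suppP.toFinset.exists_max_image dfcount hne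
  have hxE : xE ∈ D.suppP := List.mem_toFinset.mp hxE'
  have hxF : xF ∈ D.suppP := List.mem_toFinset.mp hxF'
  have hxDF : xDF ∈ D.suppP := List.mem_toFinset.mp hxDF'
  have hPE : ∀ x ∈ D.suppP, ecount x ≤ ecount xE := fun x hx => hmaxE' x (List.mem_toFinset.mpr hx)
  have hPF : ∀ x ∈ D.suppP, fcount x ≤ fcount xF := fun x hx => hmaxF' x (List.mem_toFinset.mpr hx)
  have hPDF : ∀ x ∈ D.suppP, dfcount x ≤ dfcount xDF := fun x hx => hmaxDF' x (List.mem_toFinset.mpr hx)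
  have hNE : ∀ y ∈ D.suppN, x11count y ≤ ecount xE := fun y hy => by
    obtain ⟨x, hx, h⟩ := hNC y hy; exact le_trans h.1 (hPE x hx)
  have hNF : ∀ y ∈ D.suppN, nbcount y ≤ fcount xF := fun y hy => by
    obtain ⟨x, hx, h⟩ := hNC y hy; exact le_trans h.2.1 (hPF x hx)
  have hNDF : ∀ y ∈ D.suppN, qnbcount y ≤ dfcount xDF := fun y hy => by
    obtain ⟨x, hx, h⟩ := hNC y hy; exact le_trans h.2.2 (hPDF x hx)
  have hcopZ : (D.copies : ℤ) ≤ 199 := by exact_mod_cast le_trans hcop hB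
  have hE4 := ecount_le_four xE
  have hF4 := fcount_le_four xF
  have hDF4 := dfcount_le_four xDF
  have hFDF : fcount xF ≤ dfcount xDF := le_trans (fcount_le_dfcount xF) (hPDF xF hxF)
  have hPE4 : ∀ x ∈ D.suppP, ecount x ≤ 4 := fun x _ => ecount_le_four x
  have hNE4 : ∀ y ∈ D.suppN, x11count y ≤ 4 := fun y hy => le_trans (hNE y hy) hE4
  -- case split on (kF, kDF); the branch (3, 4) further on kE
  rcases (show fcount xF = 0 ∨ fcount xF = 1 ∨ fcount xF = 2 ∨ fcount xF = 3 ∨ fcount xF = 4 by omega) with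
    hkF | hkF | hkF | hkF | hkF
  · -- kF = 0
    rcases (show dfcount xDF = 0 ∨ dfcount xDF = 1 ∨ dfcount xDF = 2 ∨ dfcount xDF = 3 ∨ dfcount xDF = 4 by omega) with
      hkDF | hkDF | hkDF | hkDF | hkDF
    · -- (kF, kDF) = (0, 0): μ-free certificate, L = 0
      have hb := branch_pos_e D h1 hP hN 4 0 0 hPE4 (fun x hx => (hPF x hx).trans hkF.le) (fun x hx => (hPDF x hx).trans hkDF.le) hNE4 (fun y hy => (hNF y hy).trans hkF.le) (fun y hy => (hNDF y hy).trans hkDF.le)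
        γ00s 0 0 690144 0 le_rfl (by norm_num) le_rfl (Or.inl rfl) (Or.inr ⟨xF, hxF, hkF⟩) (Or.inr ⟨xDF, hxDF, hkDF⟩)
        chkN_00s chkP_00s
      linarith
    · -- (kF, kDF) = (0, 1)
      have hb := branch_pos_e D h1 hP hN 4 0 1 hPE4 (fun x hx => (hPF x hx).trans hkF.le) (fun x hx => (hPDF x hx).trans hkDF.le) hNE4 (fun y hy => (hNF y hy).trans hkF.le) (fun y hy => (hNDF y hy).trans hkDF.le)
        γx01 0 0 0 234240 le_rfl (by norm_num) (by norm_num) (Or.inl rfl) (Or.inr ⟨xF, hxF, hkF⟩) (Or.inr ⟨xDF, hxDF, hkDF⟩)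
        chkN_x01 chkP_x01
      linarith
    · -- (kF, kDF) = (0, 2)
      have hb := branch_pos_e D h1 hP hN 4 0 2 hPE4 (fun x hx => (hPF x hx).trans hkF.le) (fun x hx => (hPDF x hx).trans hkDF.le) hNE4 (fun y hy => (hNF y hy).trans hkF.le) (fun y hy => (hNDF y hy).trans hkDF.le)
        γx02 24 0 0 29232 le_rfl (by norm_num) (by norm_num) (Or.inl rfl) (Or.inr ⟨xF, hxF, hkF⟩) (Or.inr ⟨xDF, hxDF, hkDF⟩)
        chkN_x02 chkP_x02
      linarith
    · -- (kF, kDF) = (0, 3)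
      have hb := branch_pos_e D h1 hP hN 4 0 3 hPE4 (fun x hx => (hPF x hx).trans hkF.le) (fun x hx => (hPDF x hx).trans hkDF.le) hNE4 (fun y hy => (hNF y hy).trans hkF.le) (fun y hy => (hNDF y hy).trans hkDF.le)
        γx03 9720 0 0 8744400 le_rfl (by norm_num) (by norm_num) (Or.inl rfl) (Or.inr ⟨xF, hxF, hkF⟩) (Or.inr ⟨xDF, hxDF, hkDF⟩)
        chkN_x03 chkP_x03
      linarith
    · -- (kF, kDF) = (0, 4)
      have hb := branch_pos_e D h1 hP hN 4 0 4 hPE4 (fun x hx => (hPF x hx).trans hkF.le) (fun x hx => (hPDF x hx).trans hkDF.le) hNE4 (fun y hy => (hNF y hy).trans hkF.le) (fun y hy => (hNDF y hy).trans hkDF.le)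
        γx04 7776 0 0 15627360 le_rfl (by norm_num) (by norm_num) (Or.inl rfl) (Or.inr ⟨xF, hxF, hkF⟩) (Or.inr ⟨xDF, hxDF, hkDF⟩)
        chkN_x04 chkP_x04
      linarith
  · -- kF = 1
    rcases (show dfcount xDF = 0 ∨ dfcount xDF = 1 ∨ dfcount xDF = 2 ∨ dfcount xDF = 3 ∨ dfcount xDF = 4 by omega) with
      hkDF | hkDF | hkDF | hkDF | hkDF
    · -- (kF, kDF) = (1, 0)
      exfalso; omega
    · -- (kF, kDF) = (1, 1)
      have hb := branch_pos_e D h1 hP hN 4 1 1 hPE4 (fun x hx => (hPF x hx).trans hkF.le) (fun x hx => (hPDF x hx).trans hkDF.le) hNE4 (fun y hy => (hNF y hy).trans hkF.le) (fun y hy => (hNDF y hy).trans hkDF.le)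
        γx11 0 0 200112 587352 le_rfl (by norm_num) (by norm_num) (Or.inl rfl) (Or.inr ⟨xF, hxF, hkF⟩) (Or.inr ⟨xDF, hxDF, hkDF⟩)
        chkN_x11 chkP_x11
      linarith
    · -- (kF, kDF) = (1, 2)
      have hb := branch_pos_e D h1 hP hN 4 1 2 hPE4 (fun x hx => (hPF x hx).trans hkF.le) (fun x hx => (hPDF x hx).trans hkDF.le) hNE4 (fun y hy => (hNF y hy).trans hkF.le) (fun y hy => (hNDF y hy).trans hkDF.le)
        γx12 3072 0 352240 996544 le_rfl (by norm_num) (by norm_num) (Or.inl rfl) (Or.inr ⟨xF, hxF, hkF⟩) (Or.inr ⟨xDF, hxDF, hkDF⟩)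
        chkN_x12 chkP_x12
      linarith
    · -- (kF, kDF) = (1, 3)
      have hb := branch_pos_e D h1 hP hN 4 1 3 hPE4 (fun x hx => (hPF x hx).trans hkF.le) (fun x hx => (hPDF x hx).trans hkDF.le) hNE4 (fun y hy => (hNF y hy).trans hkF.le) (fun y hy => (hNDF y hy).trans hkDF.le)
        γx13 1679616 0 67354668 474933504 le_rfl (by norm_num) (by norm_num) (Or.inl rfl) (Or.inr ⟨xF, hxF, hkF⟩) (Or.inr ⟨xDF, hxDF, hkDF⟩)
        chkN_x13 chkP_x13
      linarith
    · -- (kF, kDF) = (1, 4)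
      have hb := branch_pos_e D h1 hP hN 4 1 4 hPE4 (fun x hx => (hPF x hx).trans hkF.le) (fun x hx => (hPDF x hx).trans hkDF.le) hNE4 (fun y hy => (hNF y hy).trans hkF.le) (fun y hy => (hNDF y hy).trans hkDF.le)
        γx14 635040 0 8929488 350813856 le_rfl (by norm_num) (by norm_num) (Or.inl rfl) (Or.inr ⟨xF, hxF, hkF⟩) (Or.inr ⟨xDF, hxDF, hkDF⟩)
        chkN_x14 chkP_x14
      linarith
  · -- kF = 2
    rcases (show dfcount xDF = 0 ∨ dfcount xDF = 1 ∨ dfcount xDF = 2 ∨ dfcount xDF = 3 ∨ dfcount xDF = 4 by omega) with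
      hkDF | hkDF | hkDF | hkDF | hkDF
    · -- (kF, kDF) = (2, 0)
      exfalso; omega
    · -- (kF, kDF) = (2, 1)
      exfalso; omega
    · -- (kF, kDF) = (2, 2)
      have hb := branch_pos_e D h1 hP hN 4 2 2 hPE4 (fun x hx => (hPF x hx).trans hkF.le) (fun x hx => (hPDF x hx).trans hkDF.le) hNE4 (fun y hy => (hNF y hy).trans hkF.le) (fun y hy => (hNDF y hy).trans hkDF.le)
        γx22 384 0 135656 0 le_rfl (by norm_num) (by norm_num) (Or.inl rfl) (Or.inr ⟨xF, hxF, hkF⟩) (Or.inr ⟨xDF, hxDF, hkDF⟩)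
        chkN_x22 chkP_x22
      linarith
    · -- (kF, kDF) = (2, 3)
      have hb := branch_pos_e D h1 hP hN 4 2 3 hPE4 (fun x hx => (hPF x hx).trans hkF.le) (fun x hx => (hPDF x hx).trans hkDF.le) hNE4 (fun y hy => (hNF y hy).trans hkF.le) (fun y hy => (hNDF y hy).trans hkDF.le)
        γx23 24576 0 2634344 4124544 le_rfl (by norm_num) (by norm_num) (Or.inl rfl) (Or.inr ⟨xF, hxF, hkF⟩) (Or.inr ⟨xDF, hxDF, hkDF⟩)
        chkN_x23 chkP_x23
      linarith
    · -- (kF, kDF) = (2, 4)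
      have hb := branch_pos_e D h1 hP hN 4 2 4 hPE4 (fun x hx => (hPF x hx).trans hkF.le) (fun x hx => (hPDF x hx).trans hkDF.le) hNE4 (fun y hy => (hNF y hy).trans hkF.le) (fun y hy => (hNDF y hy).trans hkDF.le)
        γx24 2801952 0 89127952 586497312 le_rfl (by norm_num) (by norm_num) (Or.inl rfl) (Or.inr ⟨xF, hxF, hkF⟩) (Or.inr ⟨xDF, hxDF, hkDF⟩)
        chkN_x24 chkP_x24
      linarith
  · -- kF = 3
    rcases (show dfcount xDF = 0 ∨ dfcount xDF = 1 ∨ dfcount xDF = 2 ∨ dfcount xDF = 3 ∨ dfcount xDF = 4 by omega) with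
      hkDF | hkDF | hkDF | hkDF | hkDF
    · -- (kF, kDF) = (3, 0)
      exfalso; omega
    · -- (kF, kDF) = (3, 1)
      exfalso; omega
    · -- (kF, kDF) = (3, 2)
      exfalso; omega
    · -- (kF, kDF) = (3, 3)
      have hb := branch_pos_e D h1 hP hN 4 3 3 hPE4 (fun x hx => (hPF x hx).trans hkF.le) (fun x hx => (hPDF x hx).trans hkDF.le) hNE4 (fun y hy => (hNF y hy).trans hkF.le) (fun y hy => (hNDF y hy).trans hkDF.le)
        γx33 1608768 0 409918368 0 le_rfl (by norm_num) (by norm_num) (Or.inl rfl) (Or.inr ⟨xF, hxF, hkF⟩) (Or.inr ⟨xDF, hxDF, hkDF⟩)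
        chkN_x33 chkP_x33
      linarith
    · -- (kF, kDF) = (3, 4)
      rcases (show ecount xE = 0 ∨ ecount xE = 1 ∨ ecount xE = 2 ∨ ecount xE = 3 ∨ ecount xE = 4 by omega) with
        hkE | hkE | hkE | hkE | hkE
      · -- kE = 0
        have hb := branch_pos_e D h1 hP hN 0 3 4 (fun x hx => (hPE x hx).trans hkE.le) (fun x hx => (hPF x hx).trans hkF.le) (fun x hx => (hPDF x hx).trans hkDF.le)
          (fun y hy => (hNE y hy).trans hkE.le) (fun y hy => (hNF y hy).trans hkF.le) (fun y hy => (hNDF y hy).trans hkDF.le) γ034 106944 0 8689356 13353408 (by norm_num) (by norm_num) (by norm_num)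
          (Or.inr ⟨xE, hxE, hkE⟩) (Or.inr ⟨xF, hxF, hkF⟩) (Or.inr ⟨xDF, hxDF, hkDF⟩) chkN_034 chkP_034
        linarith
      · -- kE = 1
        have hb := branch_pos_e D h1 hP hN 1 3 4 (fun x hx => (hPE x hx).trans hkE.le) (fun x hx => (hPF x hx).trans hkF.le) (fun x hx => (hPDF x hx).trans hkDF.le)
          (fun y hy => (hNE y hy).trans hkE.le) (fun y hy => (hNF y hy).trans hkF.le) (fun y hy => (hNDF y hy).trans hkDF.le) γ134 133824 3312 10347240 16291008 (by norm_num) (by norm_num) (by norm_num)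
          (Or.inr ⟨xE, hxE, hkE⟩) (Or.inr ⟨xF, hxF, hkF⟩) (Or.inr ⟨xDF, hxDF, hkDF⟩) chkN_134 chkP_134
        linarith
      · -- kE = 2
        have hb := branch_pos_e D h1 hP hN 2 3 4 (fun x hx => (hPE x hx).trans hkE.le) (fun x hx => (hPF x hx).trans hkF.le) (fun x hx => (hPDF x hx).trans hkDF.le)
          (fun y hy => (hNE y hy).trans hkE.le) (fun y hy => (hNF y hy).trans hkF.le) (fun y hy => (hNDF y hy).trans hkDF.le) γ234 1833024 7353360 140217384 220115520 (by norm_num) (by norm_num) (by norm_num)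
          (Or.inr ⟨xE, hxE, hkE⟩) (Or.inr ⟨xF, hxF, hkF⟩) (Or.inr ⟨xDF, hxDF, hkDF⟩) chkN_234 chkP_234
        linarith
      · -- kE = 3
        have hb := branch_pos_e D h1 hP hN 3 3 4 (fun x hx => (hPE x hx).trans hkE.le) (fun x hx => (hPF x hx).trans hkF.le) (fun x hx => (hPDF x hx).trans hkDF.le)
          (fun y hy => (hNE y hy).trans hkE.le) (fun y hy => (hNF y hy).trans hkF.le) (fun y hy => (hNDF y hy).trans hkDF.le) γ334 145440 4363200 10922520 17430048 (by norm_num) (by norm_num) (by norm_num)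
          (Or.inr ⟨xE, hxE, hkE⟩) (Or.inr ⟨xF, hxF, hkF⟩) (Or.inr ⟨xDF, hxDF, hkDF⟩) chkN_334 chkP_334
        linarith
      · -- kE = 4
        have hb := branch_pos_e D h1 hP hN 4 3 4 (fun x hx => (hPE x hx).trans hkE.le) (fun x hx => (hPF x hx).trans hkF.le) (fun x hx => (hPDF x hx).trans hkDF.le)
          (fun y hy => (hNE y hy).trans hkE.le) (fun y hy => (hNF y hy).trans hkF.le) (fun y hy => (hNDF y hy).trans hkDF.le) γ434 4986036 930783528 363329016 591150708 (by norm_num) (by norm_num) (by norm_num)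
          (Or.inr ⟨xE, hxE, hkE⟩) (Or.inr ⟨xF, hxF, hkF⟩) (Or.inr ⟨xDF, hxDF, hkDF⟩) chkN_434 chkP_434
        linarith
  · -- kF = 4
    rcases (show dfcount xDF = 0 ∨ dfcount xDF = 1 ∨ dfcount xDF = 2 ∨ dfcount xDF = 3 ∨ dfcount xDF = 4 by omega) with
      hkDF | hkDF | hkDF | hkDF | hkDF
    · -- (kF, kDF) = (4, 0)
      exfalso; omega
    · -- (kF, kDF) = (4, 1)
      exfalso; omega
    · -- (kF, kDF) = (4, 2)
      exfalso; omega
    · -- (kF, kDF) = (4, 3)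
      exfalso; omega
    · -- (kF, kDF) = (4, 4)
      have hb := branch_pos_e D h1 hP hN 4 4 4 hPE4 (fun x hx => (hPF x hx).trans hkF.le) (fun x hx => (hPDF x hx).trans hkDF.le) hNE4 (fun y hy => (hNF y hy).trans hkF.le) (fun y hy => (hNDF y hy).trans hkDF.le)
        γx44 2993760 0 754078848 0 le_rfl (by norm_num) (by norm_num) (Or.inl rfl) (Or.inr ⟨xF, hxF, hkF⟩) (Or.inr ⟨xDF, hxDF, hkDF⟩)
        chkN_x44 chkP_x44
      linarith

/-- **STRONG RING 5** (full (A1), no μ, no rank): `RingsEmptyStrong 14 B 5` for every `B ≤ 199`. -/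
theorem ringsEmptyStrong_colevel_five (B : ℕ) (hB : B ≤ 199) : RingsEmptyStrong 14 B 5 :=
  ringsEmptyStrong_of_E 14 B 5 (ringsEmptyE_colevel_five B hB)

/-- the instance of record in strong form -/
theorem ringsEmptyStrong_14_199_5 : RingsEmptyStrong 14 199 5 := ringsEmptyStrong_colevel_five 199 le_rfl

/-- sanity: the filed `RingsEmpty 14 199 8 5` is a corollary of the strong form. -/
example : RingsEmpty 14 199 8 5 := ringsEmpty_of_strong 14 199 8 5 ringsEmptyStrong_14_199_5

/-- **Strong closure**: colour-1's μ-free depth bound `DepthBoundStrong 14 199 5` would close the widened (A4) road at `M ≤ 199` for EVERY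
non-zero (A1)-clean design, charged or not. -/
theorem strong_closed_of_depthBoundStrong_five (hd : DepthBoundStrong 14 199 5) :
    ∀ D : Design, D.OnAlphabet 14 → D.A1 → D.A4 → D.suppP ≠ [] → D.copies ≤ 199 → False :=
  a4_closed_strong 14 199 5 hd ringsEmptyStrong_14_199_5

/-! ### Leg A corollaries in the three depth-bound forms at `c₀ = 5` -/

/-- A bound on the co-levels of the P-letters of an (A4) design bounds every supported letter (N-letters sit ≥ 2 co-levels higher). -/
theorem colevel_all_of_P (D : Design) (hA : D.OnAlphabet 14) (h4 : D.A4) (c₀ : ℤ)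
    (hP : ∀ c ∈ D.suppP, ∀ f : Fin 4, (c f).colevel ≤ c₀) : ∀ c ∈ D.suppN ++ D.suppP, ∀ f : Fin 4, (c f).colevel ≤ c₀ := by
  intro c hc f
  rcases List.mem_append.mp hc with hN | hPm
  · obtain ⟨x, hx, hlive⟩ := h4.2 c hN
    have hxc : (x f).colevel ≤ c₀ := hP x hx f
    have hhx : (x f).height = 14 := (hA x (List.mem_append.mpr (Or.inr hx)) f).1
    have hhc : (c f).height = 14 := (hA c hc f).1
    have := colevel_drop_two (x f) (c f) (hhx.trans hhc.symm) (hlive f)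
    linarith
  · exact hP c hPm f

/-- **Leg A from the P-letters-only depth bound** (director R19.375 (1) wording at `c₀ = 5`). -/
theorem a4_closed_of_depthBoundP_five (hd : DepthBoundP 14 199 8 5) :
    ∀ D : Design, D.OnAlphabet 14 → D.A1 → D.A4 → D.mu ≠ 0 → D.copies ≤ 199 → 8 ≤ D.rank → False :=
  a4_closed_of_depthBound_five (depthBound_of_depthBoundP 14 199 8 5 hd)

/-- **Leg A from colour-1's `DB 5`** (six hypotheses: (A1), `μ ≠ 0`, rank `≥ 8`, (A4♯), (CONN), `M ≤ 199`; conclusion on P-letters):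
no (A4♯) ∧ (CONN) design of the widened road exists at `M ≤ 199`, `r ≥ 8`. -/
theorem a4sharp_closed_of_DB_five (hd : DB 5) :
    ∀ D : Design, D.OnAlphabet 14 → D.A1 → D.mu ≠ 0 → 8 ≤ D.rank → D.A4sharp → D.CONN → D.copies ≤ 199 → False := by
  intro D hA h1 hμ hr hs hc hB
  have h4 : D.A4 := D.a4_of_sharp_conn hs hc
  have hP : ∀ c ∈ D.suppP, ∀ f : Fin 4, (c f).colevel ≤ 5 := fun c hc' f => by
    have h := hd D hA h1 hμ hr hs hc hB c hc' f
    exact_mod_cast h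
  exact ringsEmpty_14_199_8_5 D hA h1 h4 hμ hB hr (colevel_all_of_P D hA h4 5 hP)

/-- The three depth statements at `c₀ = 5`, strongest to weakest: `DepthBound → DepthBoundP → DB` (tree lemmas, instantiated). -/
theorem depth_five_chain :
    (DepthBound 14 199 8 5 → DepthBoundP 14 199 8 5) ∧ (DepthBoundP 14 199 8 5 → DB 5) :=
  ⟨depthBoundP_of_depthBound 14 199 8 5, fun h => depthBoundC1_of_depthBoundP 14 199 8 5 h⟩

end Summit.HodgeConjecture.HodgeConjecture.Cruxes.BlochSeedDiscOne.RingFiveEmpty
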